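import Mathlib
import HarnessLib
import Literature.MathematicalPhysics.QuantumFieldTheory.YangMillsOS
import Summits.QuantumFields.YangMills.Theorems.MirrorModularBoostsHypercubicLimitCouplingResponseDefs
import Summits.QuantumFields.YangMills.Theorems.MirrorModularBoostsHypercubicLimitIRInputsDefs

/-!
# Line `Sketch` (coupling response): the two halves of `OneFieldClauses` and the RP-spectral clause (Defs G, reshape 4)

Definitions file for crux `stmt-QuantumFields-16154` (`HypercubicLimit`), line `Sketch`.  The closure stub is cut into a SOFT half
(no reflection: E0-normalisation, E0′, E3, translations on `⁰𝒮`, the convergence clause, non-triviality, non-Gaussianity, the uniform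
lattice gap) and a REFLECTION half (E0-hermiticity, E2, E4, proper-hypercubic invariance on `⁰𝒮`, the continuum mass gap) at a COMMON
rate `Δ`; `oneFieldClauses_of_halves` reassembles them (pure logic).  `RPSpectral r sch Δ C` names clause (b) of `IRInputs` so that the
reflection half can consume it at the same `Δ` (`irInputs_iff`).  Nothing is asserted.
-/

noncomputable section

open scoped SchwartzMap
open MeasureTheory Filter Topology
open Literature.MathematicalPhysics.AQFT Literature.MathematicalPhysics.QuantumLattice
open Literature.MathematicalPhysics.QuantumFieldTheory

namespace Summit.QuantumFields.YangMills.Cruxes.HypercubicLimit.CouplingResponse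

section Objects

variable {G : Type} [Group G] [TopologicalSpace G] [IsTopologicalGroup G] [CompactSpace G]
  [MeasurableSpace G] [BorelSpace G]

/-- **Clause (b) of `IRInputs`, named**: RP-spectral relative clustering of reflected slab functionals at rate `Δ a_k` per lattice
time step on every torus at least the scheme's, with the thermal (periodic-image) error `C B² e^{−Δ a_k S}`. [folklore] -/
def RPSpectral (r : LatticeRep G) (sch : SpeciesScheme (YMSpecies G)) (Δ C : ℝ) : Prop :=
  ∀ᶠ k in atTop, ∀ (S T n : ℕ), sch.L k ≤ S → 2 * (T + n + 1) ≤ S →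
    ∀ (Y : LGConfig 4 G → ℝ) (B : ℝ), Measurable Y → (∀ U, |Y U| ≤ B) →
      DependsOn Y {e : Literature.MathematicalPhysics.QuantumLattice.ZdEdge 4 |
        1 ≤ e.1 0 ∧ e.1 0 + (if e.2 = 0 then 1 else 0) ≤ T} →
        |(∫ U, Y (torusLift (2 * S + 1) (GaugeConfig.timeReflect U)) *
              Y (configShift (-Pi.single 0 (n : ℤ)) (torusLift (2 * S + 1) U))
            ∂(wilsonMeasure r.ρ (sch.β k) : Measure (GaugeConfig 4 (2 * S + 1) G))) -
          (∫ U, Y (torusLift (2 * S + 1) U)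
            ∂(wilsonMeasure r.ρ (sch.β k) : Measure (GaugeConfig 4 (2 * S + 1) G))) ^ 2| ≤
          Real.exp (-(Δ * sch.a k * n)) *
            ((∫ U, Y (torusLift (2 * S + 1) (GaugeConfig.timeReflect U)) * Y (torusLift (2 * S + 1) U)
                ∂(wilsonMeasure r.ρ (sch.β k) : Measure (GaugeConfig 4 (2 * S + 1) G))) -
              (∫ U, Y (torusLift (2 * S + 1) U)
                ∂(wilsonMeasure r.ρ (sch.β k) : Measure (GaugeConfig 4 (2 * S + 1) G))) ^ 2) +
          C * B ^ 2 * Real.exp (-(Δ * sch.a k * S))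

/-- **The SOFT half of the one-field clauses** at rate `Δ` (everything that needs no reflection): E0-normalisation, E0′, E3,
invariance under all translations on `⁰𝒮`, the convergence clause along `sch`, non-triviality, non-Gaussianity, and the uniform
lattice gap `HasLatticeMassGap r sch Δ`. [folklore] -/
def SoftHalf (r : LatticeRep G) (sch : SpeciesScheme (YMSpecies G))
    (S₁ : SchwingerFamily (EuclideanSpace ℝ (Fin 4))) (Δ : ℝ) : Prop :=
  S₁.toLabelled.IsNormalized ∧ S₁.toLabelled.HasLinearGrowth ∧ S₁.toLabelled.IsSymmetric ∧
  (∀ (n : ℕ) (k : Fin n → Unit) (a : EuclideanSpace ℝ (Fin 4))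
      (F : 𝓢((Fin n → EuclideanSpace ℝ (Fin 4)), ℂ)), IsOffDiagonal F →
    S₁.toLabelled n k (translateMulti a F) = S₁.toLabelled n k F) ∧
  (∀ (n : ℕ), n ≠ 0 → ∀ (f : Fin n → 𝓢(EuclideanSpace ℝ (Fin 4), ℝ))
      (F : 𝓢((Fin n → EuclideanSpace ℝ (Fin 4)), ℂ)),
    IsTensorOf F (fun i => ofRealTest (f i)) → IsOffDiagonal F →
      Tendsto (fun k : ℕ =>
        ((latticeSchwinger r.ρ sch (fun s => s.F) k n (fun _ => r.curvature) f : ℝ) : ℂ))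
        atTop (𝓝 (S₁ n F))) ∧
  (∃ (F₁ G₁ : 𝓢((Fin 1 → EuclideanSpace ℝ (Fin 4)), ℂ))
      (H₁ : 𝓢((Fin (1 + 1) → EuclideanSpace ℝ (Fin 4)), ℂ)),
    IsTimeOrdered F₁ ∧ IsTimeOrdered G₁ ∧ IsAppendTensorOf H₁ (osAdjoint F₁) G₁ ∧
      S₁.toLabelled (1 + 1) (fun _ => ()) H₁ ≠
        S₁.toLabelled 1 (fun _ => ()) (osAdjoint F₁) * S₁.toLabelled 1 (fun _ => ()) G₁) ∧
  (∃ (f g h : 𝓢(EuclideanSpace ℝ (Fin 4), ℂ)) (Ffgh : 𝓢((Fin 3 → EuclideanSpace ℝ (Fin 4)), ℂ))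
      (Fgh Ffh Ffg : 𝓢((Fin 2 → EuclideanSpace ℝ (Fin 4)), ℂ))
      (Ff Fg Fh : 𝓢((Fin 1 → EuclideanSpace ℝ (Fin 4)), ℂ)),
    IsTensorOf Ffgh ![f, g, h] ∧ IsOffDiagonal Ffgh ∧ IsTensorOf Fgh ![g, h] ∧
    IsTensorOf Ffh ![f, h] ∧ IsTensorOf Ffg ![f, g] ∧ IsTensorOf Ff ![f] ∧ IsTensorOf Fg ![g] ∧
    IsTensorOf Fh ![h] ∧
      S₁.toLabelled 3 (fun _ => ()) Ffgh - S₁.toLabelled 1 (fun _ => ()) Ff * S₁.toLabelled 2 (fun _ => ()) Fgh -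
        S₁.toLabelled 1 (fun _ => ()) Fg * S₁.toLabelled 2 (fun _ => ()) Ffh -
        S₁.toLabelled 1 (fun _ => ()) Fh * S₁.toLabelled 2 (fun _ => ()) Ffg +
        2 * (S₁.toLabelled 1 (fun _ => ()) Ff * S₁.toLabelled 1 (fun _ => ()) Fg *
          S₁.toLabelled 1 (fun _ => ()) Fh) ≠ 0) ∧
  HasLatticeMassGap r sch Δ

/-- **The REFLECTION half of the one-field clauses** at rate `Δ`: E0-hermiticity, E2, E4, proper-hypercubic invariance on `⁰𝒮`,
and the continuum mass gap `HasMassGap Δ`. [folklore] -/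
def ReflHalf (S₁ : SchwingerFamily (EuclideanSpace ℝ (Fin 4))) (Δ : ℝ) : Prop :=
  S₁.toLabelled.IsHermitian ∧ S₁.toLabelled.IsReflectionPositive ∧ S₁.toLabelled.HasClusterProperty ∧
  (∀ (n : ℕ) (k : Fin n → Unit) (R : EuclideanSpace ℝ (Fin 4) ≃ₗᵢ[ℝ] EuclideanSpace ℝ (Fin 4)),
    LinearMap.det (R.toLinearEquiv : EuclideanSpace ℝ (Fin 4) →ₗ[ℝ] EuclideanSpace ℝ (Fin 4)) = 1 →
    (∀ i : Fin 4, ∃ j : Fin 4, R (EuclideanSpace.single i 1) = EuclideanSpace.single j 1 ∨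
      R (EuclideanSpace.single i 1) = -EuclideanSpace.single j 1) →
    ∀ F : 𝓢((Fin n → EuclideanSpace ℝ (Fin 4)), ℂ), IsOffDiagonal F →
      S₁.toLabelled n k (linActMulti R F) = S₁.toLabelled n k F) ∧
  S₁.toLabelled.HasMassGap Δ

end Objects

section Facts

variable {G : Type} [Group G] [TopologicalSpace G] [IsTopologicalGroup G] [CompactSpace G]
  [MeasurableSpace G] [BorelSpace G]

/-- `IRInputs` unbundled through `RPSpectral` (definitional). [folklore] -/
theorem irInputs_iff (r : LatticeRep G) (sch : SpeciesScheme (YMSpecies G)) :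
    IRInputs r sch ↔
      (∃ Δ C : ℝ, 0 < Δ ∧ HasLatticeMassGap r sch Δ ∧ RPSpectral r sch Δ C) ∧
      (∃ (u v : 𝓢(EuclideanSpace ℝ (Fin 4), ℝ)) (δ : ℝ),
        tsupport u ⊆ {y : EuclideanSpace ℝ (Fin 4) | y 0 < 0} ∧
        tsupport v ⊆ {y : EuclideanSpace ℝ (Fin 4) | 0 < y 0} ∧ 0 < δ ∧
        ∀ᶠ k in atTop, δ ≤
          |latticeSchwinger r.ρ sch (fun s => s.F) k (1 + 1) (fun _ => r.curvature) ![u, v] -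
            latticeSchwinger r.ρ sch (fun s => s.F) k 1 (fun _ => r.curvature) ![u] *
              latticeSchwinger r.ρ sch (fun s => s.F) k 1 (fun _ => r.curvature) ![v]|) ∧
      (∃ (f g h : 𝓢(EuclideanSpace ℝ (Fin 4), ℝ)) (δ : ℝ),
        Disjoint (tsupport f) (tsupport g) ∧ Disjoint (tsupport f) (tsupport h) ∧
        Disjoint (tsupport g) (tsupport h) ∧ 0 < δ ∧
        ∀ᶠ k in atTop, δ ≤
          |latticeSchwinger r.ρ sch (fun s => s.F) k 3 (fun _ => r.curvature) ![f, g, h] -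
            latticeSchwinger r.ρ sch (fun s => s.F) k 1 (fun _ => r.curvature) ![f] *
              latticeSchwinger r.ρ sch (fun s => s.F) k 2 (fun _ => r.curvature) ![g, h] -
            latticeSchwinger r.ρ sch (fun s => s.F) k 1 (fun _ => r.curvature) ![g] *
              latticeSchwinger r.ρ sch (fun s => s.F) k 2 (fun _ => r.curvature) ![f, h] -
            latticeSchwinger r.ρ sch (fun s => s.F) k 1 (fun _ => r.curvature) ![h] *
              latticeSchwinger r.ρ sch (fun s => s.F) k 2 (fun _ => r.curvature) ![f, g] +
            2 * (latticeSchwinger r.ρ sch (fun s => s.F) k 1 (fun _ => r.curvature) ![f] *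
              latticeSchwinger r.ρ sch (fun s => s.F) k 1 (fun _ => r.curvature) ![g] *
              latticeSchwinger r.ρ sch (fun s => s.F) k 1 (fun _ => r.curvature) ![h])|) :=
  Iff.rfl

/-- **Reassembly of the one-field clauses from the two halves** at a common rate `Δ > 0` (pure logic). [folklore] -/
theorem oneFieldClauses_of_halves (r : LatticeRep G) (sch : SpeciesScheme (YMSpecies G))
    (S₁ : SchwingerFamily (EuclideanSpace ℝ (Fin 4))) {Δ : ℝ} (hΔ : 0 < Δ)
    (hs : SoftHalf r sch S₁ Δ) (hr : ReflHalf S₁ Δ) : OneFieldClauses r sch S₁ := by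
  obtain ⟨hE0, hE0', hE3, htr, hconv, hNT, hNG, hlat⟩ := hs
  obtain ⟨hherm, hRP, hcl, hhyp, hgap⟩ := hr
  exact ⟨⟨hE0, hherm, hE0', hRP, hE3, hcl, htr, hhyp⟩, hconv, hNT, hNG, Δ, hΔ, hgap, hlat⟩

end Facts

/-- **Registered sub-goal `oneFieldClauses_of_halves'` (line `Sketch`, reshape 4)**: closed form of the reassembly. [folklore] -/
theorem oneFieldClauses_of_halves' :
    ∀ (G : Type) [Group G] [TopologicalSpace G] [IsTopologicalGroup G] [CompactSpace G] [MeasurableSpace G] [BorelSpace G] (r : LatticeRep G) (sch : SpeciesScheme (YMSpecies G)) (S₁ : SchwingerFamily (EuclideanSpace ℝ (Fin 4))) (Δ : ℝ), 0 < Δ → SoftHalf r sch S₁ Δ → ReflHalf S₁ Δ → OneFieldClauses r sch S₁ :=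
  fun _ _ _ _ _ _ _ r sch S₁ _ hΔ hs hr => oneFieldClauses_of_halves r sch S₁ hΔ hs hr

end Summit.QuantumFields.YangMills.Cruxes.HypercubicLimit.CouplingResponse

end
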